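import Literature.Barriers.QuantumAdvantage.SeparationPrerequisites
import Literature.Computability.Complexity.CountingProofs
import Literature.Computability.QuantumComplexity.ClassicalClassesProofs
import Literature.Computability.QuantumComplexity.BQPSubsetPP
import HarnessLib

/-!
# Barrier `SeparationPrerequisites` (Bernstein–Vazirani 1997, §1): assemblies with the discharged facts fed in

Sibling proof file of `Literature/Barriers/QuantumAdvantage/SeparationPrerequisites.lean` (the
barrier entry stays light on imports; this file imports the `FinTM2` toolkit through
`CountingProofs.lean`). The catalogue fact

`SeparationPrerequisites : (∃ L, L ∈ BQP ∧ L ∉ BPP) → ¬ PP ⊆ BPP ∧ P ≠ PP ∧ P ≠ P^{#P} ∧ P ≠ PSPACE`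

is proved in the entry file from THREE tree facts (`SeparationPrerequisites.of_facts`:
`BQP_subset_PP`, `PP_subset_PSharpP`, `PP_subset_PSPACE`). Of these, `PP ⊆ P^{#P}` is discharged
in the tree (`Literature.Computability.Complexity.PP_subset_PSharpP_holds`, Arora–Barak 2009,
§17.2.1), so the trust base shrinks to two named facts; moreover the fourth conjunct only needs
`BQP ⊆ PSPACE` (Bernstein–Vazirani 1997, Thm. 8.4, tree fact `BQP_subset_PSPACE`), not
`PP ⊆ PSPACE`. This file records the resulting assemblies:

* `P_ne_PSharpP_of_witness'` — `P ≠ P^{#P}` from a witness and `BQP ⊆ PP` alone;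
* `P_ne_PSPACE_of_witness_of_BQP_subset_PSPACE` — `P ≠ PSPACE` from a witness and `BQP ⊆ PSPACE`
  alone (the literal content of BV97 Thm. 8.4 + §1);
* `SeparationPrerequisites.of_BQP_subset_PP_of_PP_subset_PSPACE` and
  `SeparationPrerequisites.of_BQP_subset_PP_of_BQP_subset_PSPACE` — the fact from two named facts.

`PP ⊆ PSPACE` is discharged too (`PP_subset_PSPACE_holds`, Gill 1977, Prop. 5.2(i),
`QuantumComplexity/ClassicalClassesProofs.lean`: the loop machine of `Complexity/SpaceLoop.lean`
iterating the majority-vote enumeration of `Complexity/MajorityEnumeration.lean`), whence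
`SeparationPrerequisites.of_BQP_subset_PP` (trust base `{BQP_subset_PP}`). With `BQP ⊆ PP` discharged as
well (`BQP_subset_PP_holds`, Adleman–DeMarrais–Huang 1997, `QuantumComplexity/BQPSubsetPP.lean`) the
barrier fact is a THEOREM: `SeparationPrerequisites_holds`.

## References

* E. Bernstein, U. Vazirani, *Quantum complexity theory*, SIAM J. Comput. 26 (1997) 1411–1473
  [BernsteinVazirani1997SICOMP] (held: `paper:doi-10-1145-167088-167097`): §1 p. 1414
  (PDF p. 4: "BPP ⊆ BQP ⊆ P^{#P} … unless there is a major breakthrough in complexity theory"),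
  Thm. 8.4 (`BQP ⊆ PSPACE`) and Thm. 8.6 (`BQP ⊆ P^{#P}`), pp. 1451–1452 (PDF pp. 41–42).
* S. Arora, B. Barak, *Computational Complexity: A Modern Approach*, CUP 2009, §17.2.1
  (`PP ⊆ P^{#P}`), through `CountingProofs.lean`.
-/

noncomputable section

namespace Literature.Barriers.QuantumAdvantage

open _root_.Computability Literature.Computability.Complexity Literature.Computability.Complexity.Classes Literature.Computability.Cryptography Literature.Computability.QuantumComplexity

/-- `P ≠ P^{#P}` from a witness of the summit and `BQP ⊆ PP` alone: `PP ⊆ P^{#P}` is the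
discharged tree fact `PP_subset_PSharpP_holds`.
[cite: BernsteinVazirani1997SICOMP, §1 p. 1414 and Thm. 8.6 (BQP ⊆ P^{#P})] -/
theorem P_ne_PSharpP_of_witness' (hPP : BQP_subset_PP)
    (h : ∃ L : Language Bool, L ∈ BQP ∧ L ∉ BPP) : P ≠ PSharpP :=
  P_ne_PSharpP_of_witness hPP PP_subset_PSharpP_holds h

/-- `P ≠ PSPACE` from a witness of the summit and `BQP ⊆ PSPACE` alone (no detour through
`PP`): if `P = PSPACE` then the witness lies in `BQP ⊆ PSPACE = P ⊆ BPP` (`P_subset_BPP_holds`).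
[cite: BernsteinVazirani1997SICOMP, §1 p. 1414 and Thm. 8.4 (BQP ⊆ PSPACE)] -/
theorem P_ne_PSPACE_of_witness_of_BQP_subset_PSPACE (hBS : BQP_subset_PSPACE)
    (h : ∃ L : Language Bool, L ∈ BQP ∧ L ∉ BPP) : P ≠ PSPACE := by
  obtain ⟨L, hL, hLB⟩ := h
  intro hP
  have hLP : L ∈ P := hP ▸ hBS hL
  exact hLB (P_subset_BPP_holds hLP)

/-- `SeparationPrerequisites` from the two named facts `BQP ⊆ PP` and `PP ⊆ PSPACE`
(`PP ⊆ P^{#P}` being discharged, `PP_subset_PSharpP_holds`).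
[cite: BernsteinVazirani1997SICOMP, §1 p. 1414] -/
theorem SeparationPrerequisites.of_BQP_subset_PP_of_PP_subset_PSPACE (hPP : BQP_subset_PP)
    (hPS : PP_subset_PSPACE) : SeparationPrerequisites :=
  SeparationPrerequisites.of_facts hPP PP_subset_PSharpP_holds hPS

/-- `SeparationPrerequisites` from the two named facts `BQP ⊆ PP` and `BQP ⊆ PSPACE`
(Bernstein–Vazirani's own pair of upper bounds, Thm. 8.6 sharpened by Adleman–DeMarrais–Huang
and Thm. 8.4). [cite: BernsteinVazirani1997SICOMP, §1 p. 1414, Thm. 8.4 and Thm. 8.6] -/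
theorem SeparationPrerequisites.of_BQP_subset_PP_of_BQP_subset_PSPACE (hPP : BQP_subset_PP)
    (hBS : BQP_subset_PSPACE) : SeparationPrerequisites :=
  fun h => ⟨not_PP_subset_BPP_of_witness hPP h, P_ne_PP_of_witness hPP h,
    P_ne_PSharpP_of_witness' hPP h, P_ne_PSPACE_of_witness_of_BQP_subset_PSPACE hBS h⟩

/-- `SeparationPrerequisites` from the single named fact `BQP ⊆ PP`: `PP ⊆ P^{#P}` AND `PP ⊆ PSPACE`
are now discharged in the tree (`PP_subset_PSharpP_holds`; `PP_subset_PSPACE_holds`, Gill 1977,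
Prop. 5.2(i), `QuantumComplexity/ClassicalClassesProofs.lean`). The remaining hypothesis is the
Adleman–DeMarrais–Huang theorem. [cite: BernsteinVazirani1997SICOMP, §1 p. 1414] -/
theorem SeparationPrerequisites.of_BQP_subset_PP (hPP : BQP_subset_PP) : SeparationPrerequisites :=
  SeparationPrerequisites.of_BQP_subset_PP_of_PP_subset_PSPACE hPP PP_subset_PSPACE_holds

/-- In any world where `PP ⊆ BPP` (e.g. `P = PP`), the summit fails, given `BQP ⊆ PP` only.
[cite: BernsteinVazirani1997SICOMP, §1 p. 1414] -/
theorem not_summit_of_PP_subset_BPP (hPP : BQP_subset_PP) (h : PP ⊆ BPP) :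
    ¬ ∃ L : Language Bool, L ∈ BQP ∧ L ∉ BPP :=
  fun hw => (SeparationPrerequisites.of_BQP_subset_PP hPP hw).1 h

/-! ### The unconditional barrier theorem -/

/-- **`SeparationPrerequisites` holds unconditionally**: every witness of the summit
`∃ L ∈ BQP, L ∉ BPP` is a witness of `PP ⊄ BPP`, `P ≠ PP`, `P ≠ P^{#P}` and `P ≠ PSPACE`. All three
inclusions of Bernstein–Vazirani's sandwich argument are now theorems of the tree:
`BQP ⊆ PP` (`BQP_subset_PP_holds`, Adleman–DeMarrais–Huang 1997, Thm. 6.4, `QuantumComplexity/BQPSubsetPP.lean`),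
`PP ⊆ P^{#P}` (`PP_subset_PSharpP_holds`) and `PP ⊆ PSPACE` (`PP_subset_PSPACE_holds`, Gill 1977,
Prop. 5.2(i)). Discharges the barrier fact `SeparationPrerequisites`.
[cite: BernsteinVazirani1997SICOMP, §1 p. 1414, Thm. 8.4 and Thm. 8.6] -/
theorem SeparationPrerequisites_holds : SeparationPrerequisites :=
  SeparationPrerequisites.of_BQP_subset_PP BQP_subset_PP_holds

/-- Hence, unconditionally: if `PP ⊆ BPP` (in particular if `P = PP`, `P = P^{#P}` or
`P = PSPACE`) then `BQP ⊆ BPP`, i.e. the summit fails. [cite: BernsteinVazirani1997SICOMP, §1 p. 1414] -/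
theorem not_summit_of_PP_subset_BPP' (h : PP ⊆ BPP) : ¬ ∃ L : Language Bool, L ∈ BQP ∧ L ∉ BPP :=
  not_summit_of_PP_subset_BPP BQP_subset_PP_holds h

/-- Unconditionally: `P = PSPACE` refutes the summit. [cite: BernsteinVazirani1997SICOMP, §1 p. 1414 and Thm. 8.4] -/
theorem not_summit_of_P_eq_PSPACE' (hP : P = PSPACE) : ¬ ∃ L : Language Bool, L ∈ BQP ∧ L ∉ BPP :=
  fun hw => (SeparationPrerequisites_holds hw).2.2.2 hP

end Literature.Barriers.QuantumAdvantage

end
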